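import Summits.QuantumFields.YangMills.Theorems.LuscherReductionTwistedTraceScalingBODoorPack
import Summits.QuantumFields.YangMills.Theorems.LuscherReductionTwistedTraceScalingBTGaussianProfile
import HarnessLib

/-!
# R43 — THE (B-OD) DOOR IS VACUOUS AS TYPED: its relative pointwise quasimode hypothesis `hQ` is UNSATISFIABLE for every nonnegative fibre profile that vanishes somewhere —
# in particular for every truncated `frozenProfile`, for the frozen stiff Gaussian `Ω_G` of record, and for every `RecordAnalyticInput` package with `Ω ≥ 0`
# (crux `TwistedTraceScaling` stmt-QuantumFields-20203, skeleton «twolattice», S-BASE C4-CORE (B-OD); standing disprover, cycle 35)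

Lane A's door for the off-diagonal brick (B-OD), `…BODoor.tubeCross_boFun_le_of_quasimode` (p677591) and its packed form `…BODoorPack.tubeCross_boFun_le_hOD_of_quasimode`
(p677925), take as input the RELATIVE pointwise quasimode bound
  `hQ : ∀ u, φ u ≠ 0 → ∀ u' v', |Φ_u(orthoTube u' v') − k(u',u)·Ω(v̂')·w(orthoTube u' v')| ≤ η·k(u',u)·Ω(v̂')·w(orthoTube u' v')`,
`Φ_u(U) = ∫_v K̃_β(U, orthoTube u v)·Ω(v̂) dπ(v)` the fibre-transferred profile, for ALL `v' : Edge 3 L → Fin 3 → ℝ`.  At any `v'` with `Ω(v̂') = 0` the right-hand side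
vanishes, so `hQ` forces `Φ_u(orthoTube u' v') = 0`; but the gauge-averaged kernel is pointwise positive (`avgKernel_pos`), so for `Ω ≥ 0` non-vanishing on a set of positive
`π`-measure `Φ_u > 0` EVERYWHERE (§1).  Hence (§2) `hQ` is false as soon as `φ ≢ 0` and `Ω` vanishes at one point `v̂'` — which every admissible profile does (support radius
`r β ≤ 1/2 < ‖v̂'‖` for a far link field, §2 `exists_norm_linkEmbed_gt`), in particular every truncated `frozenProfile L q r β` (§3), the frozen stiff Gaussian
`Ω_G β = frozenProfile L (β ↦ stiffGaussExp L (t β) (b β)) r_B β` of `…BTGaussianProfile.recordAnalyticInput_of_stiffGauss` for EVERY normalisation `(t,b)` and EVERY `β`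
(§3 ★★★ `door_quasimode_false_stiffGauss`), and `A.Ω β` for every `A : RecordAnalyticInput L s M` with `A.Ω β ≥ 0` (§3 ★★★ `door_quasimode_false_record`, via
`A.hΩr`, `A.hr`, `A.hγ`).  Consequently neither door theorem can be instantiated towards `RecordAnalyticInput.hOD` except at `φ ≡ 0`, where `hOD` is trivial: the announced
"model case `η = 0` (`stiff_groundState_stiffGaussExp`)" holds for the UNTRUNCATED Gaussian on all of `LinkSpace L`, never for an admissible (compactly supported) profile.
* §1 `support_pos_of_ball`, `support_pos_of_recordGamma_pos` (`recordGamma L Ω β > 0 ⇒ π{Ω β ∘ linkEmbed ≠ 0} > 0`), ★ `transferredProfile_pos`.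
* §2 `exists_norm_linkEmbed_gt`, ★★★ `door_quasimode_false` (abstract: `Ω ≥ 0` measurable bounded, `π{Ω∘linkEmbed ≠ 0} > 0`, `Ω(v̂₀) = 0`, `φ u₀ ≠ 0`; any `w`, `k`, `η`, `β`),
  ★★★ `door_quasimode_iff_eq_zero` (`hQ ↔ φ ≡ 0`).
* §3 ★★★ `door_quasimode_false_frozenProfile` (`r β > 0`), ★★★ `door_quasimode_false_stiffGauss` (all `t b β`), ★★★ `door_quasimode_false_record`,
  ★★★ `door_quasimode_iff_eq_zero_record` (`hQ ↔ φ ≡ 0` for every nonnegative record profile).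
CLASS (of the door as a (B-OD) stub, lane A HANDOFF-g15 FINAL/ADDENDUM "suggested first brick"): stub-misstated.  REPAIR (the minimal statement we believe dischargeable): replace
`hQ` by a two-term bound with an ABSOLUTE tail majorant `τ ≥ 0`,
  `hQ' : ∀ u, φ u ≠ 0 → ∀ u' v', |Φ_u(orthoTube u' v') − k(u',u)·Ω(v̂')·w(orthoTube u' v')| ≤ η·k(u',u)·Ω(v̂')·w(orthoTube u' v') + k(u',u)·τ(v')·w(orthoTube u' v')`,
giving `|X| ≤ η·∫_{u'}A'(u')B(u') + ∫_{u'}A'(u')·∫_{v'}|g|·τ·w` and, after the same two Cauchy–Schwarz steps, `b·σλ₀ = Λ(η√(γ₊/γ₋) + √(∫τ²w/γ₋))`; for `Ω_G` one may take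
`τ = Φ·𝟙{r_B − c β^{-1/2} < ‖v̂'‖}`-type Gaussian tails of mass `e^{−Θ(log²β)}`.  NOTE that a relative-only bound fails not only where `Ω = 0` but on the whole boundary
layer `r_B − O(β^{-1/2}) < ‖v̂'‖ ≤ r_B` of the truncation (there `Φ ≈ ½·λ_fib·e^{−q}` in the harmonic model: half of the kernel's `β^{-1/2}`-neighbourhood lies outside the
ball), so `τ` must cover that layer too.  The witness of this file does NOT bite `hQ'` (with `τ > 0` off the core the contradiction of §2 disappears).
HONEST FRAMING: a satisfiability finding about the HYPOTHESIS of two landed reduction lemmas (which remain true implications); nothing landed is contradicted; (B-OD), (B-ST),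
C4-CORE OPEN; stub of a child of the CONDITIONAL reduction route R2b1; not `¬TwistedTraceScaling`, not infinite volume, not a gap, not Clay.
-/

set_option autoImplicit false

noncomputable section

open MeasureTheory Real Filter Topology
open scoped BigOperators
open Literature.MathematicalPhysics.QuantumFieldTheory hiding SU2
open Literature.MathematicalPhysics.QuantumLattice

namespace Summit.QuantumFields.YangMills.Theorems.TwistedTraceScaling.Negative.R43

open Summit.QuantumFields.YangMills.Theorems.FemtoTransferGap
open Summit.QuantumFields.YangMills.Theorems.FemtoTransferGap.TwoLattice
open Summit.QuantumFields.YangMills.Theorems.FemtoTransferGap.TwoLattice.Avg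
open Summit.QuantumFields.YangMills.Theorems.FemtoTransferGap.TwoLattice.ConstTube
open Summit.QuantumFields.YangMills.Theorems.FemtoTransferGap.TwoLattice.Stiff (LinkSpace)

variable {L : ℕ} [NeZero L]

/-! ## §1 The fibre-transferred profile of a nonnegative, somewhere-nonzero profile is positive everywhere -/

/-- A profile non-vanishing on a ball `{‖x‖ < ρ}`, `ρ > 0`, is nonzero on a set of positive transverse measure. [folklore] -/
theorem support_pos_of_ball {Ω : LinkSpace L → ℝ} {ρ : ℝ} (hρ : 0 < ρ) (hpos : ∀ x, ‖x‖ < ρ → Ω x ≠ 0) :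
    0 < orthoTransverse L {v | Ω (linkEmbed L v) ≠ 0} :=
  lt_of_lt_of_le (orthoTransverse_ball_pos L hρ) (measure_mono fun _ hv => hpos _ hv)

/-- `recordGamma L Ω β > 0` forces `Ω β` to be nonzero on a set of positive transverse measure. [folklore] -/
theorem support_pos_of_recordGamma_pos {Ω : ℝ → LinkSpace L → ℝ} {β : ℝ} (hγ : 0 < recordGamma L Ω β) :
    0 < orthoTransverse L {v | Ω β (linkEmbed L v) ≠ 0} := by
  rw [pos_iff_ne_zero]
  intro h0
  have hae : ∀ᵐ v ∂orthoTransverse L, Ω β (linkEmbed L v) = 0 := ae_iff.mpr h0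
  unfold recordGamma boGamma at hγ
  have hint0 : ∫ v, Ω β (linkEmbed L v) ^ 2 * Real.exp (‖(gaugeModes L).starProjection (linkEmbed L v)‖ ^ 2 / powScale 1 β ^ 2) ∂orthoTransverse L = 0 := by
    refine integral_eq_zero_of_ae (hae.mono fun v hv => ?_)
    simp [hv]
  rw [hint0, mul_zero] at hγ
  exact lt_irrefl _ hγ

/-- ★ **The fibre-transferred profile is positive everywhere**: for `Ω ≥ 0` measurable, bounded and nonzero on a set of positive transverse measure,
`∫_v K̃_β(U, orthoTube u v)·Ω(v̂) dπ(v) > 0` for EVERY configuration `U` and EVERY slow point `u` (the gauge-averaged kernel is pointwise positive). [folklore] -/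
theorem transferredProfile_pos (β : ℝ) {Ω : LinkSpace L → ℝ} (hΩm : Measurable Ω) {CΩ : ℝ} (hCΩ : ∀ x, |Ω x| ≤ CΩ) (hΩ0 : ∀ x, 0 ≤ Ω x)
    (hS : 0 < orthoTransverse L {v | Ω (linkEmbed L v) ≠ 0}) (U : GaugeConfig 3 L SU2) (u : GaugeConfig 3 1 SU2) :
    0 < ∫ v, avgKernel β U (orthoTube L u v) * Ω (linkEmbed L v) ∂orthoTransverse L := by
  haveI := isFiniteMeasure_orthoTransverse L
  obtain ⟨M, hM0, hM⟩ := exists_avgKernel_le (L := L) β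
  set f : (Edge 3 L → Fin 3 → ℝ) → ℝ := fun v => avgKernel β U (orthoTube L u v) * Ω (linkEmbed L v) with hf
  have hfm : Measurable f :=
    ((measurable_avgKernel_right β U).comp (measurable_orthoTube_right u)).mul (hΩm.comp (measurable_linkEmbed L))
  have hf0 : ∀ v, 0 ≤ f v := fun v => mul_nonneg (avgKernel_pos β _ _).le (hΩ0 _)
  have hfb : ∀ v, |f v| ≤ M * CΩ := fun v => by
    rw [hf]; dsimp only
    rw [abs_mul, abs_of_pos (avgKernel_pos β _ _)]
    exact mul_le_mul (hM _ _) (hCΩ _) (abs_nonneg _) hM0.le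
  have hint : Integrable f (orthoTransverse L) := integrable_of_measurable_abs_le _ hfm hfb
  rw [integral_pos_iff_support_of_nonneg hf0 hint]
  refine lt_of_lt_of_le hS (measure_mono fun v hv => ?_)
  rw [Function.mem_support, hf]; dsimp only
  exact mul_ne_zero (avgKernel_pos β _ _).ne' hv

/-! ## §2 ★★★ The door hypothesis `hQ` is unsatisfiable -/

/-- There are link fields of arbitrarily large norm (a single far component). [folklore] -/
theorem exists_norm_linkEmbed_gt (R : ℝ) : ∃ v : Edge 3 L → Fin 3 → ℝ, R < ‖linkEmbed L v‖ := by
  let i₀ : Edge 3 L × Fin 3 := (((fun _ => 0), 0), 0)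
  refine ⟨fun e a => EuclideanSpace.single i₀ (|R| + 1) (e, a), ?_⟩
  have h : linkEmbed L (fun e a => EuclideanSpace.single i₀ (|R| + 1) (e, a)) = EuclideanSpace.single i₀ (|R| + 1) := by
    ext ea; rw [linkEmbed_apply]
  rw [h, PiLp.norm_single, Real.norm_eq_abs, abs_of_nonneg (by positivity)]
  calc R ≤ |R| := le_abs_self R
    _ < |R| + 1 := lt_add_one _

/-- ★★★ **THE RELATIVE QUASIMODE HYPOTHESIS OF THE (B-OD) DOOR IS UNSATISFIABLE.**  `Ω ≥ 0` measurable bounded, nonzero on a set of positive transverse measure, vanishing at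
one point `v̂₀`; `φ u₀ ≠ 0`.  Then for EVERY weight `w`, slow kernel `k`, constant `η` and coupling `β`, the hypothesis `hQ` of `…BODoor.tubeCross_boFun_le_of_quasimode` /
`…BODoorPack.tubeCross_boFun_le_hOD_of_quasimode` fails (test it at `(u₀, u₀, v₀)`: its right side is `0`, its left side is `Φ_{u₀}(orthoTube u₀ v₀) > 0`).
[cite: Luscher1983, §3] [cite: SjostrandZworski2007, §2] -/
theorem door_quasimode_false (β : ℝ) {Ω : LinkSpace L → ℝ} (hΩm : Measurable Ω) {CΩ : ℝ} (hCΩ : ∀ x, |Ω x| ≤ CΩ) (hΩ0 : ∀ x, 0 ≤ Ω x)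
    (hS : 0 < orthoTransverse L {v | Ω (linkEmbed L v) ≠ 0}) {v₀ : Edge 3 L → Fin 3 → ℝ} (hv₀ : Ω (linkEmbed L v₀) = 0)
    (w : GaugeConfig 3 L SU2 → ℝ) {φ : GaugeConfig 3 1 SU2 → ℝ} {u₀ : GaugeConfig 3 1 SU2} (hu₀ : φ u₀ ≠ 0)
    (k : GaugeConfig 3 1 SU2 → GaugeConfig 3 1 SU2 → ℝ) (η : ℝ) :
    ¬ (∀ u, φ u ≠ 0 → ∀ (u' : GaugeConfig 3 1 SU2) (v' : Edge 3 L → Fin 3 → ℝ),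
      |(∫ v, avgKernel β (orthoTube L u' v') (orthoTube L u v) * Ω (linkEmbed L v) ∂orthoTransverse L) - k u' u * (Ω (linkEmbed L v') * w (orthoTube L u' v'))| ≤
        η * (k u' u * (Ω (linkEmbed L v') * w (orthoTube L u' v')))) := by
  intro hQ
  have h := hQ u₀ hu₀ u₀ v₀
  simp only [hv₀, zero_mul, mul_zero, sub_zero] at h
  exact (transferredProfile_pos β hΩm hCΩ hΩ0 hS (orthoTube L u₀ v₀) u₀).ne' (abs_nonpos_iff.mp h)

/-- ★★★ **`hQ` is EQUIVALENT to `φ ≡ 0`** (abstract form): under the standing profile hypotheses of the door (`Ω ≥ 0` measurable bounded) plus "`Ω` nonzero on a set of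
positive transverse measure and zero at some `v̂₀`" (every admissible truncated profile), the relative quasimode hypothesis holds iff the slow amplitude vanishes identically —
the door is usable only where `hOD` is already trivial. [cite: Luscher1983, §3] -/
theorem door_quasimode_iff_eq_zero (β : ℝ) {Ω : LinkSpace L → ℝ} (hΩm : Measurable Ω) {CΩ : ℝ} (hCΩ : ∀ x, |Ω x| ≤ CΩ) (hΩ0 : ∀ x, 0 ≤ Ω x)
    (hS : 0 < orthoTransverse L {v | Ω (linkEmbed L v) ≠ 0}) {v₀ : Edge 3 L → Fin 3 → ℝ} (hv₀ : Ω (linkEmbed L v₀) = 0)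
    (w : GaugeConfig 3 L SU2 → ℝ) (φ : GaugeConfig 3 1 SU2 → ℝ) (k : GaugeConfig 3 1 SU2 → GaugeConfig 3 1 SU2 → ℝ) (η : ℝ) :
    (∀ u, φ u ≠ 0 → ∀ (u' : GaugeConfig 3 1 SU2) (v' : Edge 3 L → Fin 3 → ℝ),
      |(∫ v, avgKernel β (orthoTube L u' v') (orthoTube L u v) * Ω (linkEmbed L v) ∂orthoTransverse L) - k u' u * (Ω (linkEmbed L v') * w (orthoTube L u' v'))| ≤
        η * (k u' u * (Ω (linkEmbed L v') * w (orthoTube L u' v')))) ↔ ∀ u, φ u = 0 := by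
  constructor
  · intro hQ u
    by_contra hu
    exact door_quasimode_false β hΩm hCΩ hΩ0 hS hv₀ w hu k η hQ
  · intro hφ u hu
    exact absurd (hφ u) hu

/-! ## §3 ★★★ Instances: truncated frozen profiles, the frozen stiff Gaussian of record, every nonnegative `RecordAnalyticInput` profile -/

/-- ★★★ **Every truncated frozen profile** `frozenProfile L q r β` (`q β ≥ 0` measurable, `r β > 0`) violates `hQ`, at every `β`, for every `w, k, η` and every `φ ≢ 0`.
[cite: Luscher1983, §3] -/
theorem door_quasimode_false_frozenProfile {q : ℝ → LinkSpace L → ℝ} (hq : ∀ β, Measurable (q β)) (hq0 : ∀ β x, 0 ≤ q β x) {r : ℝ → ℝ} {β : ℝ} (hr : 0 < r β)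
    (w : GaugeConfig 3 L SU2 → ℝ) {φ : GaugeConfig 3 1 SU2 → ℝ} {u₀ : GaugeConfig 3 1 SU2} (hu₀ : φ u₀ ≠ 0)
    (k : GaugeConfig 3 1 SU2 → GaugeConfig 3 1 SU2 → ℝ) (η : ℝ) :
    ¬ (∀ u, φ u ≠ 0 → ∀ (u' : GaugeConfig 3 1 SU2) (v' : Edge 3 L → Fin 3 → ℝ),
      |(∫ v, avgKernel β (orthoTube L u' v') (orthoTube L u v) * frozenProfile L q r β (linkEmbed L v) ∂orthoTransverse L)
          - k u' u * (frozenProfile L q r β (linkEmbed L v') * w (orthoTube L u' v'))| ≤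
        η * (k u' u * (frozenProfile L q r β (linkEmbed L v') * w (orthoTube L u' v')))) := by
  obtain ⟨v₀, hv₀⟩ := exists_norm_linkEmbed_gt (L := L) (r β)
  have hz : frozenProfile L q r β (linkEmbed L v₀) = 0 := by
    by_contra h
    exact (not_le.mpr hv₀) (norm_le_of_frozenProfile_ne_zero q r β h)
  exact door_quasimode_false β (measurable_frozenProfile hq r β) (abs_frozenProfile_le hq0 r β) (fun x => (frozenProfile_mem_Icc hq0 r β x).1)
    (support_pos_of_ball hr fun x hx => frozenProfile_ne_zero_of_norm_lt q r β hx) hz w hu₀ k η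

/-- ★★★ **The frozen stiff Gaussian of record** `Ω_G β = frozenProfile L (β ↦ stiffGaussExp L (t β) (b β)) (β ↦ min(1/40, β^{-1/2}ℓ)) β` — the profile of
`…BTGaussianProfile.recordAnalyticInput_of_stiffGauss` — violates `hQ` at EVERY `β`, for EVERY normalisation `(t, b)`, every `w, k, η` and every `φ ≢ 0`: the (B-OD) door
cannot be opened towards the `hOD` hypothesis of `recordAnalyticInput_of_stiffGauss`. [cite: Luscher1983, §3] [cite: SjostrandZworski2007, §2] -/
theorem door_quasimode_false_stiffGauss (t b : ℝ → ℝ) (β : ℝ)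
    (w : GaugeConfig 3 L SU2 → ℝ) {φ : GaugeConfig 3 1 SU2 → ℝ} {u₀ : GaugeConfig 3 1 SU2} (hu₀ : φ u₀ ≠ 0)
    (k : GaugeConfig 3 1 SU2 → GaugeConfig 3 1 SU2 → ℝ) (η : ℝ) :
    ¬ (∀ u, φ u ≠ 0 → ∀ (u' : GaugeConfig 3 1 SU2) (v' : Edge 3 L → Fin 3 → ℝ),
      |(∫ v, avgKernel β (orthoTube L u' v') (orthoTube L u v) *
            frozenProfile L (fun β => stiffGaussExp L (t β) (b β)) (fun β => min (1 / 40) (powScale (1 / 2) β * btLog β)) β (linkEmbed L v) ∂orthoTransverse L)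
          - k u' u * (frozenProfile L (fun β => stiffGaussExp L (t β) (b β)) (fun β => min (1 / 40) (powScale (1 / 2) β * btLog β)) β (linkEmbed L v') *
              w (orthoTube L u' v'))| ≤
        η * (k u' u * (frozenProfile L (fun β => stiffGaussExp L (t β) (b β)) (fun β => min (1 / 40) (powScale (1 / 2) β * btLog β)) β (linkEmbed L v') *
          w (orthoTube L u' v')))) :=
  door_quasimode_false_frozenProfile (q := fun β => stiffGaussExp L (t β) (b β)) (r := fun β => min (1 / 40) (powScale (1 / 2) β * btLog β))
    (fun β => measurable_stiffGaussExp (t β) (b β)) (fun β x => stiffGaussExp_nonneg (t β) (b β) x)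
    (lt_min (by norm_num) (mul_pos (powScale_pos _ _) (lt_of_lt_of_le one_pos (one_le_btLog β)))) w hu₀ k η

/-- ★★★ **Every `RecordAnalyticInput` profile with `Ω β ≥ 0`** violates `hQ` at every `β` (support radius `A.r β ≤ 1/2` by `A.hΩr`, `A.hr`; positivity of the support from
`A.hγ`): the door cannot certify the `hOD` field of ANY admissible nonnegative package except at `φ ≡ 0`. [cite: Luscher1983, §3] [cite: SjostrandZworski2007, §2] -/
theorem door_quasimode_false_record {s M : ℝ} (A : RecordAnalyticInput L s M) {β : ℝ} (hΩ0 : ∀ x, 0 ≤ A.Ω β x)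
    (w : GaugeConfig 3 L SU2 → ℝ) {φ : GaugeConfig 3 1 SU2 → ℝ} {u₀ : GaugeConfig 3 1 SU2} (hu₀ : φ u₀ ≠ 0)
    (k : GaugeConfig 3 1 SU2 → GaugeConfig 3 1 SU2 → ℝ) (η : ℝ) :
    ¬ (∀ u, φ u ≠ 0 → ∀ (u' : GaugeConfig 3 1 SU2) (v' : Edge 3 L → Fin 3 → ℝ),
      |(∫ v, avgKernel β (orthoTube L u' v') (orthoTube L u v) * A.Ω β (linkEmbed L v) ∂orthoTransverse L) - k u' u * (A.Ω β (linkEmbed L v') * w (orthoTube L u' v'))| ≤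
        η * (k u' u * (A.Ω β (linkEmbed L v') * w (orthoTube L u' v')))) := by
  obtain ⟨v₀, hv₀⟩ := exists_norm_linkEmbed_gt (L := L) (A.r β)
  have hz : A.Ω β (linkEmbed L v₀) = 0 := by
    by_contra h
    exact (not_le.mpr hv₀) (A.hΩr β _ h)
  exact door_quasimode_false β (A.hΩm β) (A.hΩ1 β) hΩ0 (support_pos_of_recordGamma_pos (A.hγ β)) hz w hu₀ k η

/-- ★★★ **For every `RecordAnalyticInput` profile with `Ω β ≥ 0`, `hQ ↔ φ ≡ 0`**: the (B-OD) door, as typed, transports NO information towards `RecordAnalyticInput.hOD`.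
[cite: Luscher1983, §3] [cite: SjostrandZworski2007, §2] -/
theorem door_quasimode_iff_eq_zero_record {s M : ℝ} (A : RecordAnalyticInput L s M) {β : ℝ} (hΩ0 : ∀ x, 0 ≤ A.Ω β x)
    (w : GaugeConfig 3 L SU2 → ℝ) (φ : GaugeConfig 3 1 SU2 → ℝ) (k : GaugeConfig 3 1 SU2 → GaugeConfig 3 1 SU2 → ℝ) (η : ℝ) :
    (∀ u, φ u ≠ 0 → ∀ (u' : GaugeConfig 3 1 SU2) (v' : Edge 3 L → Fin 3 → ℝ),
      |(∫ v, avgKernel β (orthoTube L u' v') (orthoTube L u v) * A.Ω β (linkEmbed L v) ∂orthoTransverse L) - k u' u * (A.Ω β (linkEmbed L v') * w (orthoTube L u' v'))| ≤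
        η * (k u' u * (A.Ω β (linkEmbed L v') * w (orthoTube L u' v')))) ↔ ∀ u, φ u = 0 := by
  constructor
  · intro hQ u
    by_contra hu
    exact door_quasimode_false_record A hΩ0 w hu k η hQ
  · intro hφ u hu
    exact absurd (hφ u) hu

end Summit.QuantumFields.YangMills.Theorems.TwistedTraceScaling.Negative.R43

end
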